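import Mathlib.Topology.Algebra.Valued.NormedValued
import Mathlib.Topology.Algebra.LinearTopology
import Mathlib.Analysis.Normed.Group.Ultra
import Mathlib.FieldTheory.Galois.Abelian
import Literature.NumberTheory.GaloisRepresentations.LubinTateField
import Literature.NumberTheory.GaloisRepresentations.LubinTatePoints
import Literature.NumberTheory.GaloisRepresentations.LocalExistenceTheoremProofs
import Literature.NumberTheory.GaloisRepresentations.LocalGaloisGroupHenselProofs
import HarnessLib

/-!
# The division points of the Lubin–Tate formal group: `K_π^n/F` is abelian

Step P2 (conclusion) of the programme of `LocalExistenceLubinTate.lean`: for a non-archimedean local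
field `F`, a uniformizer `π` and `f = πX + X^q`, the Lubin–Tate field `K_π^{n+1} = F(λ_{n+1})`
(`Literature.ltField π n`, `LubinTateField.lean`) is an **abelian Galois extension of `F`**
(`Literature.NumberTheory.GaloisRepresentations.isAbelianGalois_ltField`) — the conjunct "`IsAbelianGalois F E`" of the norm-group fact
`Literature.NumberTheory.GaloisRepresentations.exists_abelian_norm_le_lubinTate` at every level, **proved** (Cassels–Fröhlich VI §3.6
Prop. 6; Lubin–Tate 1965 Thm. 2).  Everything in this file is proved.

## Contents and proof

* The evaluation target.  `Literature.LubinTate.unitBall L = 𝒪_L = {‖x‖ ≤ 1}` for an ultrametric normed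
  field `L` is a complete topological ring with a **linear topology** (the balls `ballIdeal` are
  ideals; `IsLinearTopology` via `IsLinearTopology.mk_of_hasBasis'`), its elements of norm `< 1`
  are topologically nilpotent and form the closed ideal `𝔪_L` (`maxNilIdeal`, a
  `LubinTate.NilIdeal`, `LubinTatePoints.lean`).  The coefficient ring is the discrete copy
  `Literature.LTCoeff F` of `𝒪[F]` (Mathlib's `MvPowerSeries.eval₂_subst` wants a discretely uniformised
  coefficient ring), acting on `𝒪_E` for every finite `E ⊆ F̄` through `F` (`coeffToUnitBall`,
  `algCoeff`, `contSMulCoeff`; the spectral norm on `E`, local instances).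
* `[π^k] x = f^{(k)}(x)` on `𝔪_E` (`coe_ltSMul_pow`: Lubin–Tate's `[π]_f = f` and the points module
  of `LubinTatePoints.lean`); `‖λ_{n+1}‖ < 1` (`norm_gen_ltField_lt_one`: Eisenstein), so
  `λ = λ_{n+1}` is a point `genPt` of `𝔪_{K_π^{n+1}}`, with `f^{(n)}(λ)^{q-1} = -π` and
  **primitivity** `f^{(k)}(λ) ≠ 0` for `k ≤ n`.
* **`a ↦ [a]λ` has kernel exactly `π^{n+1}𝒪`** (`pow_dvd_of_ltSMul_genPt_eq_zero`: `a = π^k u`,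
  `[u]` is invertible, and `[π^k]λ = f^{(k)}(λ) ≠ 0` for `k ≤ n`), hence
  `[a]λ = [b]λ ⟹ a ≡ b (mod π^{n+1})`; `[π^{n+1}]λ = 0` and every `[a]λ` is a root of `f^{(n+1)}`.
* **Counting** (`card_roots_ltPolyIter`): the `q^{n+1}` digit sums `Σ_{i≤n} s(dᵢ) πⁱ` are pairwise
  incongruent modulo `π^{n+1}` (`eq_of_pow_dvd_sum_digits_sub`), so `f^{(n+1)}` (degree `q^{n+1}`)
  has `q^{n+1}` distinct roots `[a]λ ∈ K_π^{n+1}`: it splits there with distinct roots, and every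
  root is some `[a]λ` — Cassels–Fröhlich VI §3.6 Prop. 6 (a), `E_f^{n+1} ≅ A/π^{n+1}`, and
  `K_π^{n+1} = K(E_f^{n+1})`.
* Hence `K_π^{n+1}` is a splitting field of the separable `f^{(n+1)}` (`isSplittingField_ltField`,
  `isGalois_ltField`), and every automorphism `σ` sends `λ` to some `[u_σ]λ`; since `σ` is an
  isometry fixing the coefficients, it commutes with the `[a]` (`toUnitBallHom_ltSMul`, Mathlib's
  `MvPowerSeries.comp_aeval`), so `στλ = [u_τ u_σ]λ = τσλ` and the Galois group is commutative
  (`isAbelianGalois_ltField`) — Cassels–Fröhlich VI §3.6 Prop. 6 (b), `G(K_π^n/K) ↪ U_K/U_K^n`.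

## References

* J.-P. Serre, *Local class field theory*, Ch. VI in Cassels–Fröhlich, *Algebraic Number Theory*
  (1967), §3.2 (`F(𝔪_L)`), §3.4 Thm. 3 (b), §3.6 Prop. 6 and its proof (PDF pp. 190–195 of the held
  copy).  [CasselsFrohlichANT1967]
* J. Lubin, J. Tate, *Formal complex multiplication in local fields*, Ann. of Math. 81 (1965),
  Thm. 1 (11), Thm. 2 (p. 383).  [LubinTate1965]
* J.-P. Serre, *Local Fields* (1979), Ch. I §6 (Eisenstein polynomials).  [SerreLocalFields1979]

## Mathlib reuse

`NormedField.valuation`, `Valuation.integer`, `IsLinearTopology.mk_of_hasBasis'`,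
`IsClosed.completeSpace_coe`, `AddSubgroup.isClosed_of_isOpen`,
`spectralNorm.nontriviallyNormedField`,
`spectralNorm_eq_of_equiv`, `spectralNorm_extends`, `Valued.toNontriviallyNormedField`,
`MvPowerSeries.comp_aeval`, `MvPowerSeries.aeval_eq_sum`, `Polynomial.splits_iff_card_roots`,
`Polynomial.nodup_roots_iff_of_splits`, `Polynomial.separable_map`,
`IsGalois.of_separable_splitting_field`, `PowerBasis.algHom_ext`, `PowerBasis.adjoin_gen_eq_top`,
`Function.surjInv`; from the tree: `LubinTate.lean`, `LubinTateField.lean`, `LubinTatePoints.lean`,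
`Literature.NumberTheory.GaloisRepresentations.spectralValue_lt_one_of_norm_coeff_lt_one` (`LocalGaloisGroupHenselProofs.lean`),
`Literature.NumberTheory.GaloisRepresentations.exists_valuation_eq_unifValue_zpow` (`LocalExistenceLubinTate.lean`).
-/

noncomputable section

open Filter Topology Polynomial

namespace Literature.NumberTheory.GaloisRepresentations

/-! ### Two more identities for the earlier files -/

section Supplements

open ValuativeRel GaloisRepresentations.IsNonarchimedeanLocalField

variable {F : Type*} [Field F] [ValuativeRel F] [TopologicalSpace F] [IsNonarchimedeanLocalField F]
variable (π : 𝒪[F])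

/-- `f^{(a+b)} = f^{(a)} ∘ f^{(b)}`. [folklore] -/
theorem ltPolyIter_add (a b : ℕ) :
    ltPolyIter F π (a + b) = (ltPolyIter F π a).comp (ltPolyIter F π b) := by
  induction a with
  | zero => rw [zero_add, ltPolyIter_zero, X_comp]
  | succ a ih => rw [Nat.succ_add, ltPolyIter_succ, ih, ltPolyIter_succ, comp_assoc]

/-- `f^{(m)}(0) = 0` as an evaluation in any algebra. [folklore] -/
theorem aeval_zero_ltPolyIter {B : Type*} [CommRing B] [Algebra 𝒪[F] B] (m : ℕ) :
    aeval (0 : B) (ltPolyIter F π m) = 0 := by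
  rw [← coeff_zero_eq_aeval_zero', coeff_zero_ltPolyIter, map_zero]

end Supplements

namespace LubinTate

section PointsSupplement

variable {A : Type*} [CommRing A] [UniformSpace A] [DiscreteUniformity A]
variable {S : Type*} [CommRing S] [UniformSpace S] [IsUniformAddGroup S] [IsTopologicalRing S]
  [IsLinearTopology S S] [T2Space S] [CompleteSpace S] [Algebra A S] [ContinuousSMul A S]
variable (M : NilIdeal S) {π : A} {q : ℕ} (hA : IsLTRing π q) {f : PowerSeries A}
  (hf : IsLTSeries π q f)

/-- `h(0) = 0` for a constant-term-free series: `[a] 0 = 0`. [folklore] -/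
theorem ltSMul_zero (a : A) : ltSMul M hA hf a 0 = 0 := by
  classical
  apply Subtype.ext
  unfold ltSMul evalPt₁
  rw [coe_evalPt, MvPowerSeries.aeval_eq_sum]
  change (∑' d : Unit →₀ ℕ, MvPowerSeries.coeff d (hom hA hf hf a) •
    d.prod (fun s e => ((0 : M.toIdeal) : S) ^ e)) = (0 : S)
  refine (tsum_congr fun d => ?_).trans tsum_zero
  by_cases hd : d = 0
  · subst hd
    rw [MvPowerSeries.coeff_zero_eq_constantCoeff_apply]
    change PowerSeries.constantCoeff (hom hA hf hf a) • _ = (0 : S)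
    rw [constantCoeff_hom, zero_smul]
  · obtain ⟨i, hi⟩ := Finsupp.ne_iff.mp hd
    rw [Finsupp.prod, ← Finset.prod_erase_mul _ _ (Finsupp.mem_support_iff.mpr hi)]
    simp [zero_pow hi]

end PointsSupplement

/-! ### The closed unit ball of a complete ultrametric field as an evaluation target -/

section UnitBall

variable (L : Type*) [NontriviallyNormedField L] [IsUltrametricDist L]

/-- The valuation ring `𝒪_L = {‖x‖ ≤ 1}` of an ultrametric normed field, as a subring.
[cite: CasselsFrohlichANT1967, Ch. VI §3.2] -/
abbrev unitBall : Subring L := (NormedField.valuation (K := L)).integer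

/-- Membership in `𝒪_L`: `‖x‖ ≤ 1`. [folklore] -/
theorem mem_unitBall_iff {x : L} : x ∈ unitBall L ↔ ‖x‖ ≤ 1 := by
  rw [unitBall, Valuation.mem_integer_iff, NormedField.valuation_apply, ← NNReal.coe_le_coe,
    coe_nnnorm, NNReal.coe_one]

/-- `𝒪_L` is a topological ring (subring of `L`). [folklore] -/
instance : IsTopologicalRing (unitBall L) := inferInstance

/-- `𝒪_L` is complete when `L` is (a closed ball). [folklore] -/
instance [CompleteSpace L] : CompleteSpace (unitBall L) := by
  have hc : IsClosed ((unitBall L : Subring L) : Set L) := by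
    have : ((unitBall L : Subring L) : Set L) = Metric.closedBall 0 1 := by
      ext x; simp [mem_unitBall_iff]
    rw [this]; exact Metric.isClosed_closedBall
  exact hc.completeSpace_coe

/-- The ideals `{x ∈ 𝒪_L : ‖x‖ < ε}` (`ε > 0`). [folklore] -/
def ballIdeal {ε : ℝ} (hε : 0 < ε) : Ideal (unitBall L) where
  carrier := {x | ‖(x : L)‖ < ε}
  add_mem' {a b} ha hb := by
    simp only [Set.mem_setOf_eq, Subring.coe_add] at *
    exact (IsUltrametricDist.norm_add_le_max _ _).trans_lt (max_lt ha hb)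
  zero_mem' := by simpa using hε
  smul_mem' c {x} hx := by
    simp only [Set.mem_setOf_eq, smul_eq_mul, Subring.coe_mul, norm_mul] at *
    calc ‖(c : L)‖ * ‖(x : L)‖ ≤ 1 * ‖(x : L)‖ := by
          gcongr; exact (mem_unitBall_iff L).mp c.2
      _ < ε := by rw [one_mul]; exact hx

/-- **The valuation ring of an ultrametric field is linearly topologised** (the balls around `0`
are ideals). [folklore] -/
instance : IsLinearTopology (unitBall L) (unitBall L) := by
  refine IsLinearTopology.mk_of_hasBasis' (unitBall L) (ι := {ε : ℝ // 0 < ε})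
    (S := Ideal (unitBall L)) (p := fun _ => True) (s := fun ε => ballIdeal L ε.2) ?_
    (fun I r m h => Ideal.mul_mem_left I r h)
  have hb := (Metric.nhds_basis_ball (x := (0 : unitBall L)))
  refine hb.to_hasBasis' (fun ε hε => ⟨⟨ε, hε⟩, trivial, fun x hx => ?_⟩) (fun ε _ => ?_)
  · simpa [Metric.mem_ball, dist_zero_right, ballIdeal] using hx
  · refine Filter.mem_of_superset (hb.mem_of_mem ε.2) fun x hx => ?_
    simpa [Metric.mem_ball, dist_zero_right, ballIdeal] using hx

/-- Elements of norm `< 1` of the unit ball are topologically nilpotent. [folklore] -/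
theorem isTopologicallyNilpotent_of_norm_lt_one {x : unitBall L} (hx : ‖(x : L)‖ < 1) :
    IsTopologicallyNilpotent x := by
  rw [IsTopologicallyNilpotent, Metric.tendsto_atTop]
  intro ε hε
  obtain ⟨N, hN⟩ := exists_pow_lt_of_lt_one hε hx
  refine ⟨N, fun n hn => ?_⟩
  rw [dist_zero_right]
  change ‖((x ^ n : unitBall L) : L)‖ < ε
  rw [SubmonoidClass.coe_pow, norm_pow]
  exact (pow_le_pow_of_le_one (norm_nonneg _) hx.le hn).trans_lt hN

/-- The maximal ideal `𝔪_L = {‖x‖ < 1}` of the unit ball is closed. [folklore] -/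
theorem isClosed_ballIdeal_one :
    IsClosed ((ballIdeal L one_pos : Ideal (unitBall L)) : Set (unitBall L)) := by
  -- an open additive subgroup is closed
  have hopen : IsOpen ((ballIdeal L one_pos : Ideal (unitBall L)) : Set (unitBall L)) := by
    have : ((ballIdeal L one_pos : Ideal (unitBall L)) : Set (unitBall L)) =
        (fun x : unitBall L => (x : L)) ⁻¹' Metric.ball 0 1 := by
      ext x; simp [ballIdeal, Metric.mem_ball, dist_zero_right]
    rw [this]
    exact Metric.isOpen_ball.preimage continuous_subtype_val
  exact (ballIdeal L one_pos).toAddSubgroup.isClosed_of_isOpen hopen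

end UnitBall


end LubinTate

/-! ### The discrete coefficient ring and the evaluation target for a local field -/

section Concrete

open ValuativeRel GaloisRepresentations.IsNonarchimedeanLocalField LubinTate

variable (F : Type*) [Field F] [ValuativeRel F] [TopologicalSpace F] [IsNonarchimedeanLocalField F]

/-- The valuation ring `𝒪[F]` as a *discrete* coefficient ring for power-series evaluation.
[folklore] -/
def LTCoeff : Type _ := 𝒪[F]

/-- The ring structure of `𝒪[F]` on its discrete copy. [folklore] -/
instance : CommRing (LTCoeff F) := inferInstanceAs (CommRing 𝒪[F])
/-- The discrete uniformity on the coefficient ring. [folklore] -/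
instance : UniformSpace (LTCoeff F) := ⊥
/-- The coefficient ring is discretely uniformised. [folklore] -/
instance : DiscreteUniformity (LTCoeff F) := ⟨rfl⟩
/-- … hence discrete. [folklore] -/
instance : DiscreteTopology (LTCoeff F) := inferInstance

/-- The identification `LTCoeff F = 𝒪[F]`. [folklore] -/
def LTCoeff.of : 𝒪[F] ≃+* LTCoeff F := RingEquiv.refl _

/-- `LTCoeff F` acts on `F` as `𝒪[F]` does. [folklore] -/
instance : Algebra (LTCoeff F) F := inferInstanceAs (Algebra 𝒪[F] F)

section Normed

/-- The norm on `F` (local instances, defeq to the valuative topology). [folklore] -/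
local instance : UniformSpace F := IsTopologicalAddGroup.rightUniformSpace F
/-- (local) the uniform structure of `F` is a group uniformity. [folklore] -/
local instance : IsUniformAddGroup F := isUniformAddGroup_of_addCommGroup
/-- (local) the valuation of a local field has rank one. [folklore] -/
local instance rk1 : (Valued.v (R := F)).RankOne :=
  { hom' := IsRankLeOne.nonempty.some.emb (R := F).comp MonoidWithZeroHom.ValueGroup₀.embedding
    strictMono' := IsRankLeOne.nonempty.some.strictMono.comp
        MonoidWithZeroHom.ValueGroup₀.embedding_strictMono }
/-- (local) the norm on `F` defined by the valuation (same topology). [folklore] -/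
local instance nF : NontriviallyNormedField F :=
  Valued.toNontriviallyNormedField F (ValueGroupWithZero F)

variable (E : IntermediateField F (AlgebraicClosure F)) [FiniteDimensional F E]

/-- The spectral norm on a finite subextension of `F̄` (local instance). [folklore] -/
local instance nE (E : IntermediateField F (AlgebraicClosure F)) [FiniteDimensional F E] :
    NontriviallyNormedField E := spectralNorm.nontriviallyNormedField F E

omit [FiniteDimensional F E] in
/-- The local norm on `E` is the spectral norm (unfolding). [folklore] -/
theorem norm_eq_spectralNorm [FiniteDimensional F E] (x : E) : ‖x‖ = spectralNorm F E x := rfl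

/-- The spectral norm is ultrametric. [folklore] -/
instance ultraE : IsUltrametricDist E :=
  IsUltrametricDist.isUltrametricDist_of_forall_norm_add_le_max_norm (fun a b => by
    rw [norm_eq_spectralNorm, norm_eq_spectralNorm, norm_eq_spectralNorm]
    exact isNonarchimedean_spectralNorm (K := F) (L := E) a b)

/-- `𝒪[F] → 𝒪_E`, `x ↦ x`. [folklore] -/
def coeffToUnitBall : LTCoeff F →+* unitBall E where
  toFun x := ⟨algebraMap F E ((LTCoeff.of F).symm x : 𝒪[F]), by
    rw [mem_unitBall_iff, norm_eq_spectralNorm, spectralNorm_extends,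
      Valued.toNormedField.norm_le_one_iff]
    exact ((LTCoeff.of F).symm x).2⟩
  map_one' := by ext; simp
  map_mul' x y := by ext; simp
  map_zero' := by ext; simp
  map_add' x y := by ext; simp

/-- `𝒪_E` as an algebra over the discrete coefficient ring. [folklore] -/
instance algCoeff : Algebra (LTCoeff F) (unitBall E) := (coeffToUnitBall F E).toAlgebra

/-- The discrete coefficient ring acts continuously on `𝒪_E`. [folklore] -/
instance contSMulCoeff : ContinuousSMul (LTCoeff F) (unitBall E) := by
  refine ⟨?_⟩
  refine continuous_prod_of_discrete_left.mpr fun a => ?_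
  change Continuous fun s : unitBall E => (coeffToUnitBall F E a) * s
  exact continuous_const_mul _

/-- `𝒪_E` is a complete, Hausdorff, linearly topologised ring — the hypotheses of the evaluation
layer of `LubinTatePoints.lean` (sanity check; the instances are found automatically). [folklore] -/
example : CompleteSpace (unitBall E) ∧ IsLinearTopology (unitBall E) (unitBall E) ∧
    T2Space (unitBall E) :=
  ⟨inferInstance, inferInstance, inferInstance⟩

/-- The maximal ideal `𝔪_E = {‖x‖ < 1}` of `𝒪_E` as a closed nil ideal: the domain of the
Lubin–Tate points. [cite: CasselsFrohlichANT1967, Ch. VI §3.2] -/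
def maxNilIdeal : NilIdeal (unitBall E) where
  toIdeal := ballIdeal E one_pos
  isClosed := isClosed_ballIdeal_one E
  isTopologicallyNilpotent _ hx := isTopologicallyNilpotent_of_norm_lt_one E hx

variable {F}

/-- The Lubin–Tate hypotheses for the discrete coefficient ring.
[cite: CasselsFrohlichANT1967, Ch. VI §3.5 Prop. 5, Remark 2] -/
theorem isLTRing_LTCoeff {π : 𝒪[F]} (hπ : (valuation F).IsUniformizer (π : F)) :
    IsLTRing (LTCoeff.of F π) (residueFieldCard F) :=
  isLTRing_integer F hπ

/-- `f = πX + X^q` over the discrete coefficient ring.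
[cite: CasselsFrohlichANT1967, Ch. VI §3.3 Example (a)] -/
theorem isLTSeries_LTCoeff (π : 𝒪[F]) :
    IsLTSeries (LTCoeff.of F π) (residueFieldCard F)
      (((ltPoly F π : 𝒪[F][X]) : PowerSeries 𝒪[F]) : PowerSeries (LTCoeff F)) :=
  isLTSeries_ltPoly F

/-- The plain inclusion `𝒪[F] → 𝒪_E` as an algebra (same map as `algCoeff`). [folklore] -/
instance algInteger : Algebra 𝒪[F] (unitBall E) :=
  ((coeffToUnitBall F E).comp (LTCoeff.of F).toRingHom).toAlgebra

/-- The inclusion `𝒪[F] → 𝒪_E → E` is the inclusion `𝒪[F] → F → E` (unfolding). [folklore] -/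
theorem algebraMap_integer_apply (x : 𝒪[F]) :
    ((algebraMap 𝒪[F] (unitBall E) x : unitBall E) : E) = algebraMap F E x := rfl

/-- Polynomial evaluation in `𝒪_E` agrees with evaluation in `E`. [folklore] -/
theorem coe_aeval_integer (x : unitBall E) (p : Polynomial 𝒪[F]) :
    ((Polynomial.aeval x p : unitBall E) : E) =
      Polynomial.aeval (x : E) (p.map (algebraMap 𝒪[F] F)) := by
  rw [Polynomial.aeval_map_algebraMap, Polynomial.aeval_def, Polynomial.aeval_def,
    show ((Polynomial.eval₂ (algebraMap 𝒪[F] (unitBall E)) x p : unitBall E) : E) =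
      (unitBall E).subtype (Polynomial.eval₂ (algebraMap 𝒪[F] (unitBall E)) x p) from rfl,
    Polynomial.hom_eval₂]
  rfl

/-- Evaluation over `LTCoeff F` is evaluation over `𝒪[F]` (the algebras agree). [folklore] -/
theorem aeval_LTCoeff_eq (x : unitBall E) (p : Polynomial 𝒪[F]) :
    (Polynomial.aeval (R := LTCoeff F) x (p.map (LTCoeff.of F).toRingHom) : unitBall E) =
      Polynomial.aeval x p := by
  rw [Polynomial.aeval_def, Polynomial.aeval_def, Polynomial.eval₂_map]
  rfl

variable {E}
variable {π : 𝒪[F]} (hπ : (valuation F).IsUniformizer (π : F))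

/-- `[π] y = f(y)` in `𝒪_E`, with `f = πX + X^q` evaluated as a polynomial over `𝒪[F]`.
[cite: LubinTate1965, §1 Thm. 1 (11)] -/
theorem coe_ltSMul_pi (y : (maxNilIdeal F E).toIdeal) :
    ((ltSMul (maxNilIdeal F E) (isLTRing_LTCoeff hπ) (isLTSeries_LTCoeff π) (LTCoeff.of F π) y :
      unitBall E) : E) =
      Polynomial.aeval ((y : unitBall E) : E) ((ltPoly F π).map (algebraMap 𝒪[F] F)) := by
  rw [coe_ltSMul_self (maxNilIdeal F E) (isLTRing_LTCoeff hπ) (isLTSeries_LTCoeff π)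
    (fp := (ltPoly F π : Polynomial (LTCoeff F))) rfl, ← coe_aeval_integer]
  rfl

/-- **`[π^k] x = f^{(k)}(x)`** on points of `𝔪_E`.
[cite: CasselsFrohlichANT1967, Ch. VI §3.6 Prop. 6 (proof)] -/
theorem coe_ltSMul_pow (k : ℕ) (x : (maxNilIdeal F E).toIdeal) :
    ((ltSMul (maxNilIdeal F E) (isLTRing_LTCoeff hπ) (isLTSeries_LTCoeff π)
        ((LTCoeff.of F π) ^ k) x : unitBall E) : E) =
      Polynomial.aeval ((x : unitBall E) : E) ((ltPolyIter F π k).map (algebraMap 𝒪[F] F)) := by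
  induction k with
  | zero =>
    rw [pow_zero, one_ltSMul, ltPolyIter_zero, Polynomial.map_X, Polynomial.aeval_X]
  | succ k ih =>
    rw [pow_succ', mul_ltSMul, coe_ltSMul_pi hπ, ltPolyIter_succ, Polynomial.map_comp,
      Polynomial.aeval_comp, ← ih]

include hπ in
/-- **The Lubin–Tate root lies in `𝔪`**: `‖λ_{n+1}‖ < 1` (its minimal polynomial `φ_{n+1}` is
Eisenstein: all non-leading coefficients have norm `< 1`).
[cite: SerreLocalFields1979, Ch. I §6 Prop. 17] -/
theorem norm_gen_ltField_lt_one (n : ℕ) [FiniteDimensional F (ltField π n)] :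
    ‖(IntermediateField.AdjoinSimple.gen F (ltRoot π n) : ltField π n)‖ < 1 := by
  rw [norm_eq_spectralNorm, spectralNorm, IntermediateField.minpoly_gen, minpoly_ltRoot π hπ n]
  refine spectralValue_lt_one_of_norm_coeff_lt_one fun k hk => ?_
  rw [(monic_ltPolyDiv π n).1.natDegree_map, (monic_ltPolyDiv π n).2.1] at hk
  have hπm : π ∈ 𝓂[F] := (mem_maximalIdeal_iff_valuation_lt_one _).mpr hπ.val_lt_one
  have h0 : IsLocalRing.residue 𝒪[F] ((ltPolyDiv F π n).coeff k) = 0 := by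
    rw [← Polynomial.coeff_map, map_residue_ltPolyDiv π hπm, Polynomial.coeff_X_pow, if_neg hk.ne]
  rw [IsLocalRing.residue_eq_zero_iff, mem_maximalIdeal_iff_valuation_lt_one] at h0
  rw [Polynomial.coeff_map, Valued.toNormedField.norm_lt_one_iff]
  exact h0

omit hπ in
/-- The Lubin–Tate root as a point of `𝔪_{K_π^{n+1}}`.
[cite: CasselsFrohlichANT1967, Ch. VI §3.6] -/
def genPt (n : ℕ) : (maxNilIdeal F (ltField π n)).toIdeal :=
  ⟨⟨(IntermediateField.AdjoinSimple.gen F (ltRoot π n) : ltField π n),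
    (mem_unitBall_iff _).mpr (norm_gen_ltField_lt_one hπ n).le⟩, norm_gen_ltField_lt_one hπ n⟩

include hπ in
/-- `f^{(n)}(λ_{n+1})^{q-1} = -π` (`λ_{n+1}` is a root of `φ_{n+1} = (f^{(n)})^{q-1} + π`).
[cite: CasselsFrohlichANT1967, Ch. VI §3.6 Prop. 6 (proof)] -/
theorem aeval_gen_ltPolyIter_pow (n : ℕ) :
    (aeval (IntermediateField.AdjoinSimple.gen F (ltRoot π n) : ltField π n)
        ((ltPolyIter F π n).map (algebraMap 𝒪[F] F))) ^ (residueFieldCard F - 1) =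
      -(algebraMap F (ltField π n) (π : F)) := by
  have h : aeval (IntermediateField.AdjoinSimple.gen F (ltRoot π n) : ltField π n)
      ((ltPolyDiv F π n).map (algebraMap 𝒪[F] F)) = 0 := by
    rw [← minpoly_ltRoot π hπ n]
    exact IntermediateField.aeval_gen_minpoly F (ltRoot π n)
  rw [ltPolyDiv, Polynomial.map_add, Polynomial.map_pow, Polynomial.map_C, aeval_add, map_pow,
    aeval_C, add_eq_zero_iff_eq_neg] at h
  exact h

include hπ in
/-- **Primitivity**: `f^{(k)}(λ_{n+1}) ≠ 0` for `k ≤ n`.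
[cite: CasselsFrohlichANT1967, Ch. VI §3.6 Prop. 6 (proof)] -/
theorem aeval_gen_ltPolyIter_ne_zero {n k : ℕ} (hk : k ≤ n) :
    aeval (IntermediateField.AdjoinSimple.gen F (ltRoot π n) : ltField π n)
      ((ltPolyIter F π k).map (algebraMap 𝒪[F] F)) ≠ 0 := by
  intro h0
  have hq : 1 < residueFieldCard F := one_lt_residueFieldCard F
  have hn : aeval (IntermediateField.AdjoinSimple.gen F (ltRoot π n) : ltField π n)
      ((ltPolyIter F π n).map (algebraMap 𝒪[F] F)) = 0 := by
    have hsplit : ltPolyIter F π n = (ltPolyIter F π (n - k)).comp (ltPolyIter F π k) := by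
      rw [← ltPolyIter_add, Nat.sub_add_cancel hk]
    rw [hsplit, Polynomial.map_comp, aeval_comp, h0, aeval_map_algebraMap, aeval_zero_ltPolyIter]
  have h := aeval_gen_ltPolyIter_pow hπ n
  rw [hn, zero_pow (by omega), eq_comm, neg_eq_zero, _root_.map_eq_zero] at h
  exact hπ.ne_zero h

include hπ in
/-- Decomposition `a = π^k u` in `𝒪[F]`. [folklore] -/
theorem exists_eq_pow_mul_unit {a : 𝒪[F]} (ha : a ≠ 0) :
    ∃ (k : ℕ) (u : 𝒪[F]ˣ), a = π ^ k * u := by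
  have ha' : (a : F) ≠ 0 := fun h => ha (Subtype.ext h)
  have hπ0 : (π : F) ≠ 0 := hπ.ne_zero
  obtain ⟨m, hm⟩ := exists_valuation_eq_unifValue_zpow F ha'
  have hm0 : 0 ≤ m := by
    by_contra hneg
    push Not at hneg
    have h1 : valuation F (a : F) ≤ 1 := a.2
    rw [hm] at h1
    exact not_lt.mpr h1 (one_lt_zpow_of_neg₀ (unifValue_pos F) (unifValue_lt_one F) hneg)
  obtain ⟨k, rfl⟩ := Int.eq_ofNat_of_zero_le hm0
  have hu : valuation F ((a : F) / (π : F) ^ k) = 1 := by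
    rw [map_div₀, map_pow, hm, show valuation F (π : F) = unifValue F from hπ, zpow_natCast,
      div_self (pow_ne_zero _ (unifValue_ne_zero F))]
  have hu1 : valuation F ((a : F) / (π : F) ^ k) ≤ 1 := hu.le
  set u₀ : 𝒪[F] := ⟨(a : F) / (π : F) ^ k, hu1⟩ with hu₀
  have huu : IsUnit u₀ := (Valuation.Integers.isUnit_iff_valuation_eq_one
    (Valuation.integer.integers (valuation F))).mpr hu
  refine ⟨k, huu.unit, Subtype.ext ?_⟩
  rw [Subring.coe_mul, SubmonoidClass.coe_pow, IsUnit.unit_spec]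
  change (a : F) = (π : F) ^ k * ((a : F) / (π : F) ^ k)
  rw [mul_div_cancel₀ _ (pow_ne_zero _ hπ0)]

include hπ in
/-- **The kernel of `a ↦ [a] λ_{n+1}` is `π^{n+1} 𝒪`** (injectivity half of Cassels–Fröhlich VI
§3.6 Prop. 6 (b) / Lubin–Tate 1965 Thm. 2: `E_f^{n+1} ≅ 𝒪/π^{n+1}` via `a ↦ [a]λ`).
[cite: CasselsFrohlichANT1967, Ch. VI §3.6 Prop. 6 (a)] -/
theorem pow_dvd_of_ltSMul_genPt_eq_zero {n : ℕ} {a : 𝒪[F]}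
    (h : ltSMul (maxNilIdeal F (ltField π n)) (isLTRing_LTCoeff hπ) (isLTSeries_LTCoeff π)
      (LTCoeff.of F a) (genPt hπ n) = 0) :
    π ^ (n + 1) ∣ a := by
  by_cases ha : a = 0
  · rw [ha]; exact dvd_zero _
  obtain ⟨k, u, rfl⟩ := exists_eq_pow_mul_unit hπ ha
  rcases Nat.lt_or_ge n k with hk | hk
  · exact Dvd.dvd.mul_right (pow_dvd_pow π hk) _
  · exfalso
    -- `[u]([π^k] λ) = 0`, hence `[π^k] λ = 0`
    set M := maxNilIdeal F (ltField π n)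
    have hA := isLTRing_LTCoeff (F := F) hπ
    have hmul : LTCoeff.of F (π ^ k * (u : 𝒪[F])) =
        LTCoeff.of F (u : 𝒪[F]) * (LTCoeff.of F π) ^ k := by
      rw [map_mul, map_pow, mul_comm]
    rw [hmul, mul_ltSMul] at h
    have h2 := congrArg (ltSMul M hA (isLTSeries_LTCoeff π) (LTCoeff.of F ((u⁻¹ : 𝒪[F]ˣ) : 𝒪[F]))) h
    rw [← mul_ltSMul, ← map_mul, Units.inv_mul, map_one, one_ltSMul, ltSMul_zero] at h2
    have h3 := congrArg (fun y : M.toIdeal => ((y : unitBall (ltField π n)) : ltField π n)) h2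
    change (((ltSMul M hA (isLTSeries_LTCoeff π) (LTCoeff.of F π ^ k) (genPt hπ n)) :
      unitBall (ltField π n)) : ltField π n) = ((0 : unitBall (ltField π n)) : ltField π n) at h3
    rw [coe_ltSMul_pow hπ] at h3
    exact aeval_gen_ltPolyIter_ne_zero hπ hk (by simpa [genPt] using h3)

include hπ in
/-- `[a]λ = [b]λ ⟹ a ≡ b (mod π^{n+1})`. [cite: CasselsFrohlichANT1967, Ch. VI §3.6 Prop. 6 (a)] -/
theorem pow_dvd_sub_of_ltSMul_genPt_eq {n : ℕ} {a b : 𝒪[F]}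
    (h : ltSMul (maxNilIdeal F (ltField π n)) (isLTRing_LTCoeff hπ) (isLTSeries_LTCoeff π)
        (LTCoeff.of F a) (genPt hπ n) =
      ltSMul (maxNilIdeal F (ltField π n)) (isLTRing_LTCoeff hπ) (isLTSeries_LTCoeff π)
        (LTCoeff.of F b) (genPt hπ n)) :
    π ^ (n + 1) ∣ a - b := by
  set M := maxNilIdeal F (ltField π n)
  have hA := isLTRing_LTCoeff (F := F) hπ
  have hf := isLTSeries_LTCoeff (F := F) π
  refine pow_dvd_of_ltSMul_genPt_eq_zero hπ ?_
  rw [_root_.map_sub, sub_eq_add_neg, add_ltSMul, h,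
    show -(LTCoeff.of F b) = (-1) * LTCoeff.of F b by ring, mul_ltSMul]
  exact ltAdd_ltNeg M hA hf _

include hπ in
/-- `[π^{n+1}] λ_{n+1} = 0`: `λ_{n+1}` is a `π^{n+1}`-division point.
[cite: CasselsFrohlichANT1967, Ch. VI §3.6] -/
theorem ltSMul_pow_genPt (n : ℕ) :
    ltSMul (maxNilIdeal F (ltField π n)) (isLTRing_LTCoeff hπ) (isLTSeries_LTCoeff π)
      ((LTCoeff.of F π) ^ (n + 1)) (genPt hπ n) = 0 := by
  apply Subtype.ext; apply Subtype.ext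
  change (((ltSMul _ _ _ _ (genPt hπ n)) : unitBall (ltField π n)) : ltField π n) =
    ((0 : unitBall (ltField π n)) : ltField π n)
  rw [coe_ltSMul_pow hπ, ltPolyIter_succ_eq_mul, Polynomial.map_mul, aeval_mul,
    ← minpoly_ltRoot π hπ n]
  change aeval (IntermediateField.AdjoinSimple.gen F (ltRoot π n) : ltField π n) _ *
    aeval (IntermediateField.AdjoinSimple.gen F (ltRoot π n) : ltField π n)
      (minpoly F (ltRoot π n)) = 0
  rw [IntermediateField.aeval_gen_minpoly, mul_zero]

include hπ in
/-- **Every `[a] λ_{n+1}` is a root of `f^{(n+1)}`.** [cite: CasselsFrohlichANT1967, Ch. VI §3.6] -/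
theorem aeval_ltSMul_genPt_ltPolyIter (n : ℕ) (a : 𝒪[F]) :
    aeval (((ltSMul (maxNilIdeal F (ltField π n)) (isLTRing_LTCoeff hπ) (isLTSeries_LTCoeff π)
        (LTCoeff.of F a) (genPt hπ n) : unitBall (ltField π n)) : ltField π n))
      ((ltPolyIter F π (n + 1)).map (algebraMap 𝒪[F] F)) = 0 := by
  set M := maxNilIdeal F (ltField π n)
  have hA := isLTRing_LTCoeff (F := F) hπ
  have hf := isLTSeries_LTCoeff (F := F) π
  have h := coe_ltSMul_pow hπ (E := ltField π n) (n + 1)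
    (ltSMul M hA hf (LTCoeff.of F a) (genPt hπ n))
  rw [← h, ← mul_ltSMul, mul_comm, mul_ltSMul, ltSMul_pow_genPt hπ n, ltSMul_zero]
  rfl

/-! #### Counting: `q^{n+1}` elements of `𝒪[F]` pairwise incongruent modulo `π^{n+1}` -/

include hπ in
omit [FiniteDimensional F E] in
/-- **`π`-adic digits**: with `s` a section of the residue map, the `q^{m}` elements
`Σ_{i < m} s(d_i) π^i` are pairwise incongruent modulo `π^{m}`.
[cite: SerreLocalFields1979, Ch. II §4 Prop. 5] -/
theorem eq_of_pow_dvd_sum_digits_sub {s : 𝓀[F] → 𝒪[F]}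
    (hs : ∀ c, IsLocalRing.residue 𝒪[F] (s c) = c) (m : ℕ) (d e : Fin m → 𝓀[F])
    (h : π ^ m ∣ ∑ i : Fin m, (s (d i) - s (e i)) * π ^ (i : ℕ)) : d = e := by
  have hπm : π ∈ 𝓂[F] := (mem_maximalIdeal_iff_valuation_lt_one _).mpr hπ.val_lt_one
  have hπ0 : π ≠ 0 := fun h0 => hπ.ne_zero (congrArg Subtype.val h0)
  induction m with
  | zero => funext i; exact i.elim0
  | succ m ih =>
    set T := ∑ i : Fin m, (s (d i.succ) - s (e i.succ)) * π ^ (i : ℕ) with hT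
    have hsum : ∑ i : Fin (m + 1), (s (d i) - s (e i)) * π ^ (i : ℕ) =
        (s (d 0) - s (e 0)) + π * T := by
      rw [Fin.sum_univ_succ, hT, Finset.mul_sum]
      simp only [Fin.val_zero, pow_zero, mul_one, Fin.val_succ, pow_succ]
      congr 1
      exact Finset.sum_congr rfl fun i _ => by ring
    rw [hsum] at h
    -- the `0`-th digit
    have hc : π ∣ s (d 0) - s (e 0) := by
      have h1 : π ∣ s (d 0) - s (e 0) + π * T := (dvd_pow_self π (Nat.succ_ne_zero m)).trans h
      exact (dvd_add_left (dvd_mul_right π T)).mp h1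
    have h0 : d 0 = e 0 := by
      obtain ⟨r, hr⟩ := hc
      have hmem : s (d 0) - s (e 0) ∈ 𝓂[F] := by rw [hr]; exact Ideal.mul_mem_right _ _ hπm
      rw [← IsLocalRing.residue_eq_zero_iff, _root_.map_sub, hs, hs, sub_eq_zero] at hmem
      exact hmem
    -- the remaining digits
    have hrest : (fun i : Fin m => d i.succ) = fun i => e i.succ := by
      refine ih _ _ ?_
      have hc0 : s (d 0) - s (e 0) = 0 := by rw [h0, sub_self]
      rw [hc0, zero_add, pow_succ'] at h
      exact (mul_dvd_mul_iff_left hπ0).mp h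
    funext i
    refine Fin.cases h0 (fun j => ?_) i
    exact congrFun hrest j

/-- The `π`-adic digit sums `Σ_{i ≤ n} s(d_i) π^i`.
[cite: SerreLocalFields1979, Ch. II §4 Prop. 5] -/
def digitSum (s : 𝓀[F] → 𝒪[F]) {m : ℕ} (d : Fin m → 𝓀[F]) : 𝒪[F] :=
  ∑ i : Fin m, s (d i) * π ^ (i : ℕ)

omit [FiniteDimensional F E] in
/-- Differences of digit sums. [folklore] -/
theorem digitSum_sub (s : 𝓀[F] → 𝒪[F]) {m : ℕ} (d e : Fin m → 𝓀[F]) :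
    digitSum (π := π) s d - digitSum (π := π) s e =
      ∑ i : Fin m, (s (d i) - s (e i)) * π ^ (i : ℕ) := by
  rw [digitSum, digitSum, ← Finset.sum_sub_distrib]
  exact Finset.sum_congr rfl fun i _ => by ring

include hπ in
/-- **All roots of `f^{(n+1)}` are the `[a] λ_{n+1}`, and they lie in `K_π^{n+1}`**: the
polynomial `f^{(n+1)}` has `q^{n+1}` distinct roots `[a]λ` in `K_π^{n+1} = F(λ_{n+1})`, hence splits
there with distinct roots (Cassels–Fröhlich VI §3.6 Prop. 6 (a)–(b): `E_f^{n+1} ≅ A/π^{n+1}`,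
`K_π^{n+1} = K(E_f^{n+1})`). [cite: CasselsFrohlichANT1967, Ch. VI §3.6 Prop. 6 (a)] -/
theorem card_roots_ltPolyIter (n : ℕ) :
    (((ltPolyIter F π (n + 1)).map (algebraMap 𝒪[F] F)).map (algebraMap F (ltField π n))).roots.card
        = residueFieldCard F ^ (n + 1) ∧
    (((ltPolyIter F π (n + 1)).map (algebraMap 𝒪[F] F)).map
        (algebraMap F (ltField π n))).roots.Nodup
      ∧ ∀ y ∈ (((ltPolyIter F π (n + 1)).map (algebraMap 𝒪[F] F)).map
          (algebraMap F (ltField π n))).roots,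
        ∃ a : 𝒪[F], y = ((ltSMul (maxNilIdeal F (ltField π n)) (isLTRing_LTCoeff hπ)
          (isLTSeries_LTCoeff π) (LTCoeff.of F a) (genPt hπ n) : unitBall (ltField π n)) :
            ltField π n) := by
  classical
  letI : Fintype 𝓀[F] := Fintype.ofFinite _
  set E := ltField π n
  set M := maxNilIdeal F (ltField π n)
  have hA := isLTRing_LTCoeff (F := F) hπ
  have hf := isLTSeries_LTCoeff (F := F) π
  set P := ((ltPolyIter F π (n + 1)).map (algebraMap 𝒪[F] F)).map (algebraMap F E) with hP
  -- a section of the residue map and the digit points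
  set s : 𝓀[F] → 𝒪[F] := Function.surjInv (IsLocalRing.residue_surjective (R := 𝒪[F])) with hs_def
  have hs : ∀ c, IsLocalRing.residue 𝒪[F] (s c) = c :=
    Function.surjInv_eq (IsLocalRing.residue_surjective (R := 𝒪[F]))
  set pt : (Fin (n + 1) → 𝓀[F]) → E := fun d =>
    ((ltSMul M hA hf (LTCoeff.of F (digitSum (π := π) s d)) (genPt hπ n) : unitBall E) : E) with hpt
  have hinj : Function.Injective pt := by
    intro d e hde
    have h1 : ltSMul M hA hf (LTCoeff.of F (digitSum (π := π) s d)) (genPt hπ n) =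
        ltSMul M hA hf (LTCoeff.of F (digitSum (π := π) s e)) (genPt hπ n) :=
      Subtype.ext (Subtype.ext hde)
    have h2 := pow_dvd_sub_of_ltSMul_genPt_eq hπ h1
    rw [digitSum_sub] at h2
    exact eq_of_pow_dvd_sum_digits_sub hπ hs (n + 1) d e h2
  -- degree and roots
  have hmon : P.Monic := ((monic_ltPolyIter π (n + 1)).1.map _).map _
  have hdeg : P.natDegree = residueFieldCard F ^ (n + 1) := by
    rw [hP, ((monic_ltPolyIter π (n + 1)).1.map _).natDegree_map,
      (monic_ltPolyIter π (n + 1)).1.natDegree_map, (monic_ltPolyIter π (n + 1)).2]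
  have hP0 : P ≠ 0 := hmon.ne_zero
  set T : Finset E := Finset.univ.image pt with hT
  have hTcard : T.card = residueFieldCard F ^ (n + 1) := by
    rw [hT, Finset.card_image_of_injective _ hinj, Finset.card_univ, Fintype.card_fun,
      Fintype.card_fin, ← Nat.card_eq_fintype_card]
    rfl
  have hTsub : T ⊆ P.roots.toFinset := by
    intro y hy
    rw [hT, Finset.mem_image] at hy
    obtain ⟨d, -, rfl⟩ := hy
    rw [Multiset.mem_toFinset, Polynomial.mem_roots hP0, Polynomial.IsRoot.def, hP,
      Polynomial.eval_map, ← Polynomial.aeval_def]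
    exact aeval_ltSMul_genPt_ltPolyIter hπ n _
  have hle1 : residueFieldCard F ^ (n + 1) ≤ P.roots.toFinset.card :=
    hTcard ▸ Finset.card_le_card hTsub
  have hle2 : P.roots.toFinset.card ≤ P.roots.card := Multiset.toFinset_card_le _
  have hle3 : P.roots.card ≤ residueFieldCard F ^ (n + 1) := hdeg ▸ Polynomial.card_roots' P
  have hcard : P.roots.card = residueFieldCard F ^ (n + 1) := le_antisymm hle3 (hle1.trans hle2)
  have hnodup : P.roots.Nodup := by
    rw [← Multiset.toFinset_card_eq_card_iff_nodup]
    exact le_antisymm hle2 (hcard ▸ hle1)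
  have hTeq : T = P.roots.toFinset :=
    Finset.eq_of_subset_of_card_le hTsub (by rw [hTcard]; exact hle2.trans hle3)
  refine ⟨hcard, hnodup, fun y hy => ?_⟩
  have hy' : y ∈ T := by rw [hTeq, Multiset.mem_toFinset]; exact hy
  rw [hT, Finset.mem_image] at hy'
  obtain ⟨d, -, rfl⟩ := hy'
  exact ⟨_, rfl⟩

include hπ in
/-- **`K_π^{n+1}/F` is a splitting field of `f^{(n+1)}`** (Cassels–Fröhlich VI §3.6:
`K_π^{n+1} = K(E_f^{n+1})`). [cite: CasselsFrohlichANT1967, Ch. VI §3.6] -/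
theorem isSplittingField_ltField (n : ℕ) :
    ((ltPolyIter F π (n + 1)).map (algebraMap 𝒪[F] F)).IsSplittingField F (ltField π n) := by
  classical
  obtain ⟨hcard, hnodup, -⟩ := card_roots_ltPolyIter hπ n
  have hdeg : (((ltPolyIter F π (n + 1)).map (algebraMap 𝒪[F] F)).map
      (algebraMap F (ltField π n))).natDegree = residueFieldCard F ^ (n + 1) := by
    rw [((monic_ltPolyIter π (n + 1)).1.map _).natDegree_map,
      (monic_ltPolyIter π (n + 1)).1.natDegree_map, (monic_ltPolyIter π (n + 1)).2]
  refine ⟨Polynomial.splits_iff_card_roots.mpr (hcard.trans hdeg.symm), ?_⟩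
  -- the roots generate: `λ` is among them and generates
  have hint := isIntegral_ltRoot π n
  have hgen : Algebra.adjoin F {(IntermediateField.AdjoinSimple.gen F (ltRoot π n) : ltField π n)}
      = ⊤ := (IntermediateField.adjoin.powerBasis hint).adjoin_gen_eq_top
  refine top_le_iff.mp (hgen ▸ Algebra.adjoin_mono ?_)
  rw [Set.singleton_subset_iff, Polynomial.mem_rootSet]
  refine ⟨Polynomial.map_monic_ne_zero (monic_ltPolyIter π (n + 1)).1, ?_⟩
  rw [ltPolyIter_succ_eq_mul, Polynomial.map_mul, aeval_mul, ← minpoly_ltRoot π hπ n,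
    IntermediateField.aeval_gen_minpoly, mul_zero]

include hπ in
/-- **`K_π^{n+1}/F` is Galois.** [cite: CasselsFrohlichANT1967, Ch. VI §3.6 Prop. 6 (b)] -/
theorem isGalois_ltField (n : ℕ) : IsGalois F (ltField π n) := by
  classical
  haveI := isSplittingField_ltField hπ n
  obtain ⟨hcard, hnodup, -⟩ := card_roots_ltPolyIter hπ n
  have hdeg : (((ltPolyIter F π (n + 1)).map (algebraMap 𝒪[F] F)).map
      (algebraMap F (ltField π n))).natDegree = residueFieldCard F ^ (n + 1) := by
    rw [((monic_ltPolyIter π (n + 1)).1.map _).natDegree_map,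
      (monic_ltPolyIter π (n + 1)).1.natDegree_map, (monic_ltPolyIter π (n + 1)).2]
  have hP0 : (((ltPolyIter F π (n + 1)).map (algebraMap 𝒪[F] F)).map
      (algebraMap F (ltField π n))) ≠ 0 :=
    (((monic_ltPolyIter π (n + 1)).1.map _).map _).ne_zero
  have hsep : ((ltPolyIter F π (n + 1)).map (algebraMap 𝒪[F] F)).Separable := by
    rw [← Polynomial.separable_map (algebraMap F (ltField π n)),
      ← Polynomial.nodup_roots_iff_of_splits hP0
        (Polynomial.splits_iff_card_roots.mpr (hcard.trans hdeg.symm))]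
    exact hnodup
  exact IsGalois.of_separable_splitting_field hsep

/-! #### The Galois action commutes with `[a]_f`; `K_π^{n+1}/F` is abelian -/

omit [FiniteDimensional F E] in
/-- An `F`-automorphism of `E` is an isometry for the spectral norm.
[cite: SerreLocalFields1979, Ch. II §2 Cor. 3] -/
theorem norm_algEquiv [FiniteDimensional F E] (σ : E ≃ₐ[F] E) (x : E) : ‖σ x‖ = ‖x‖ := by
  rw [norm_eq_spectralNorm, norm_eq_spectralNorm, ← spectralNorm_eq_of_equiv σ x]

/-- An `F`-automorphism restricted to the valuation ring, as a continuous algebra map over the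
coefficient ring. [folklore] -/
def toUnitBallHom (σ : E ≃ₐ[F] E) : unitBall E →ₐ[LTCoeff F] unitBall E where
  toFun x := ⟨σ x, by rw [mem_unitBall_iff, norm_algEquiv]; exact (mem_unitBall_iff E).mp x.2⟩
  map_one' := by ext; simp
  map_mul' x y := by ext; simp
  map_zero' := by ext; simp
  map_add' x y := by ext; simp
  commutes' a := by
    apply Subtype.ext
    change σ ((algebraMap (LTCoeff F) (unitBall E) a : unitBall E) : E) = _
    exact σ.commutes ((LTCoeff.of F).symm a : 𝒪[F])

omit [FiniteDimensional F E] in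
/-- `toUnitBallHom σ` is `σ` (unfolding). [folklore] -/
theorem coe_toUnitBallHom [FiniteDimensional F E] (σ : E ≃ₐ[F] E) (x : unitBall E) :
    ((toUnitBallHom σ x : unitBall E) : E) = σ x := rfl

/-- `σ` restricted to `𝒪_E` is continuous (an isometry). [folklore] -/
theorem continuous_toUnitBallHom (σ : E ≃ₐ[F] E) : Continuous (toUnitBallHom σ) := by
  have hiso : Isometry (toUnitBallHom σ) := by
    refine Isometry.of_dist_eq fun x y => ?_
    change dist (σ x : E) (σ y) = dist (x : E) y
    rw [dist_eq_norm, dist_eq_norm, ← _root_.map_sub, norm_algEquiv]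
  exact hiso.continuous

/-- The image of a point of `𝔪_E` under an automorphism, as a point. [folklore] -/
def mapPt (σ : E ≃ₐ[F] E) (x : (maxNilIdeal F E).toIdeal) : (maxNilIdeal F E).toIdeal :=
  ⟨toUnitBallHom σ x, by
    change ‖(σ (x : unitBall E) : E)‖ < 1
    rw [norm_algEquiv]; exact x.2⟩

omit [FiniteDimensional F E] in
/-- `mapPt σ x` is `σ x` (unfolding). [folklore] -/
theorem coe_mapPt [FiniteDimensional F E] (σ : E ≃ₐ[F] E) (x : (maxNilIdeal F E).toIdeal) :
    (((mapPt σ x : (maxNilIdeal F E).toIdeal) : unitBall E) : E) = σ x := rfl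

/-- **The Galois action commutes with `[a]_f`**: `σ([a] x) = [a](σ x)` (the coefficients of `[a]_f`
lie in `𝒪[F]` and `σ` is continuous).
[cite: CasselsFrohlichANT1967, Ch. VI §3.6 Prop. 6 (b) (proof)] -/
theorem toUnitBallHom_ltSMul (σ : E ≃ₐ[F] E) {hA : IsLTRing (LTCoeff.of F π) (residueFieldCard F)}
    (a : LTCoeff F) (x : (maxNilIdeal F E).toIdeal) :
    toUnitBallHom σ (ltSMul (maxNilIdeal F E) hA (isLTSeries_LTCoeff π) a x) =
      ltSMul (maxNilIdeal F E) hA (isLTSeries_LTCoeff π) a (mapPt σ x) := by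
  unfold ltSMul evalPt₁
  rw [coe_evalPt, coe_evalPt, ← AlgHom.comp_apply,
    MvPowerSeries.comp_aeval _ (continuous_toUnitBallHom σ)]
  rfl

include hπ in
/-- **`K_π^{n+1}/F` is abelian** (Cassels–Fröhlich VI §3.6 Prop. 6 (b): `G(K_π^n/K) ↪ (A/π^n)^*`;
Lubin–Tate 1965 Thm. 2): every automorphism sends `λ_{n+1}` to some `[u]λ_{n+1}`, and the `[u]`
commute with one another and with the Galois action.
[cite: CasselsFrohlichANT1967, Ch. VI §3.6 Prop. 6 (b)] -/
theorem isAbelianGalois_ltField (n : ℕ) : IsAbelianGalois F (ltField π n) := by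
  classical
  haveI := isGalois_ltField hπ n
  set E := ltField π n
  set M := maxNilIdeal F (ltField π n)
  have hA := isLTRing_LTCoeff (F := F) hπ
  have hf := isLTSeries_LTCoeff (F := F) π
  set g : E := (IntermediateField.AdjoinSimple.gen F (ltRoot π n) : ltField π n) with hg
  have hint := isIntegral_ltRoot π n
  obtain ⟨-, -, hroots⟩ := card_roots_ltPolyIter hπ n
  have hP0 : (((ltPolyIter F π (n + 1)).map (algebraMap 𝒪[F] F)).map
      (algebraMap F (ltField π n))) ≠ 0 :=
    (((monic_ltPolyIter π (n + 1)).1.map _).map _).ne_zero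
  -- every automorphism sends `λ` to some `[a] λ`
  have key : ∀ σ : E ≃ₐ[F] E, ∃ a : 𝒪[F],
      σ g = ((ltSMul M hA hf (LTCoeff.of F a) (genPt hπ n) : unitBall E) : E) := by
    intro σ
    refine hroots (σ g) ?_
    rw [Polynomial.mem_roots hP0, Polynomial.IsRoot.def, Polynomial.eval_map,
      ← Polynomial.aeval_def, Polynomial.aeval_algEquiv, AlgHom.coe_comp, Function.comp_apply]
    change σ (aeval g _) = 0
    rw [hg, ltPolyIter_succ_eq_mul, Polynomial.map_mul, aeval_mul, ← minpoly_ltRoot π hπ n,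
      IntermediateField.aeval_gen_minpoly, mul_zero, map_zero]
  have hgen : ∀ σ : E ≃ₐ[F] E, ∀ a : 𝒪[F],
      σ g = ((ltSMul M hA hf (LTCoeff.of F a) (genPt hπ n) : unitBall E) : E) →
      mapPt σ (genPt hπ n) = ltSMul M hA hf (LTCoeff.of F a) (genPt hπ n) := fun σ a h =>
    Subtype.ext (Subtype.ext h)
  refine { is_comm := ⟨fun σ τ => ?_⟩ }
  obtain ⟨a, ha⟩ := key σ
  obtain ⟨b, hb⟩ := key τ
  apply AlgEquiv.coe_toAlgHom_injective
  refine (IntermediateField.adjoin.powerBasis hint).algHom_ext ?_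
  change (σ * τ) g = (τ * σ) g
  rw [AlgEquiv.mul_apply, AlgEquiv.mul_apply, hb, ← coe_toUnitBallHom σ, toUnitBallHom_ltSMul,
    hgen σ a ha, ← mul_ltSMul, ha, ← coe_toUnitBallHom τ, toUnitBallHom_ltSMul, hgen τ b hb,
    ← mul_ltSMul, mul_comm]

end Normed












end Concrete
end Literature.NumberTheory.GaloisRepresentations
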